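import Literature.NumberTheory.GaloisRepresentations.KroneckerWeberProofs
import Literature.NumberTheory.NumberFields.TameAbsorption
import Literature.NumberTheory.NumberFields.TwoPowerKW
import Literature.NumberTheory.GaloisRepresentations.LocalExistenceReciprocity
import Mathlib.NumberTheory.NumberField.Discriminant.Different
import Mathlib.RingTheory.RootsOfUnity.AlgebraicallyClosed
import HarnessLib

/-!
# The Kronecker–Weber theorem

`theorem KroneckerWeber_holds : KroneckerWeber` — every finite abelian extension of `ℚ` (inside
`ℚ̄`) lies in a cyclotomic field `ℚ(μ_m)` — by Hilbert's proof as arranged in Marcus, *Number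
Fields*, Ch. 4, Ex. 29–36, assembled from:

* `kroneckerWeber_of_prime_pow` (`KroneckerWeberProofs.lean`, Ex. 29–30): reduction to abelian
  `L/ℚ` of prime-power degree `p^k`;
* `exists_tame_absorption_le` (`NumberFields/TameAbsorption.lean`, Ex. 31): inside an ambient
  abelian number field `M₀ ⊇ ℚ(ζ_q)`, a field of `p`-power degree ramified at `q ≠ p` is
  absorbed into `K'·ℚ(ζ_q)` with `K'` of no larger `p`-power degree, unramified at `q` and
  wherever the field was;
* `IntermediateField.le_of_isCyclotomicExtension_of_finrank_eq_odd_prime_pow`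
  (`NumberFields/OddPrimePowerKW.lean`, Ex. 33–36) and
  `IntermediateField.le_of_isCyclotomicExtension_of_finrank_eq_two_pow`
  (`NumberFields/TwoPowerKW.lean`, Ex. 32): a field of degree `p^m` unramified outside `p` lies
  in `ℚ(ζ_{p^{m+1}})` (`p` odd), resp. `ℚ(ζ_{2^{m+2}})`.

The assembly (`le_of_index_eq_prime_pow`, `KroneckerWeber_holds`): for `L ⊆ ℚ̄` abelian of
degree `p^k`, let `s` be `p` together with the primes dividing `disc L` (the only primes that can
ramify in `L`, Mathlib's `NumberField.not_dvd_discr_iff_forall_mem`), `n = p^{k+2} ∏_{q ∈ s, q ≠ p} q`,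
`ζ ∈ ℚ̄` a primitive `n`-th root of unity and `M₀ = L(ζ)`, an abelian number field
(`isAbelianGalois_sup`).  Inside `M₀`, removing the primes of `s ∖ {p}` one at a time and then
applying the prime-power case shows `L ≤ ℚ(ζ)`, whence `L ≤ ℚ(μ_n)`.

## References

* D. A. Marcus, *Number Fields*, 2nd ed., Universitext, Springer (2018), Ch. 4, Ex. 29–36
  (pp. 100–103). [Marcus2018]
* L. C. Washington, *Introduction to Cyclotomic Fields*, 2nd ed., GTM 83, Springer (1997),
  Ch. 14, Thm. 14.1. [Washington1997]
* J. W. S. Cassels, *Local Fields*, LMS Student Texts 3 (1986), Ch. 11, Thm. 12.2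
  (statement). [Cassels1986]
-/

noncomputable section

open NumberField Ideal
open scoped Pointwise IsMulCommutative

namespace Literature.NumberTheory.GaloisRepresentations

open Literature.NumberTheory.NumberFields

/-! ### Inside an ambient abelian number field: removing the ramified primes `q ≠ p` -/

section Ambient

variable {M₀ : Type*} [Field M₀] [NumberField M₀] [IsAbelianGalois ℚ M₀]

/-- **Marcus, Ch. 4, Ex. 31–36 combined, inside an abelian number field `M₀`.**  Let `p` be a
prime, `T ≤ M₀` a subfield containing cyclotomic fields `ℚ(ζ_d)` of all levels `d ∣ n`, where
`p^{k+2} ∣ n`.  If `F ≤ M₀` has `[G : H_F] = p^m` with `m ≤ k` and is unramified away from a finite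
set `s ∋ p` of primes dividing `n` (`I(Q) ≤ H_F` whenever `Q` contains no `q ∈ s`), then `F ≤ T`.
Induction on `#s`: if `s ∋ q ≠ p`, absorb `q` (`exists_tame_absorption_le`: `F ≤ K'·ℚ(ζ_q)` with
`K'` of degree `p^j`, `j ≤ m`, unramified away from `s ∖ {q}`); if `s ⊆ {p}`, `F` is unramified
outside `p` and the prime-power case applies with `ℚ(ζ_{p^{m+1}}) ≤ T` (`p` odd) or
`ℚ(ζ_{2^{m+2}}) ≤ T`. [cite: Marcus2018, Ch. 4, Ex. 31–36 (pp. 101–103)] -/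
theorem le_of_index_eq_prime_pow {p : ℕ} (hp : p.Prime) {n k : ℕ} (hpk : p ^ (k + 2) ∣ n)
    (T : IntermediateField ℚ M₀)
    (hCyc : ∀ d : ℕ, d ∣ n →
      ∃ Cy : IntermediateField ℚ M₀, Cy ≤ T ∧ IsCyclotomicExtension {d} ℚ Cy) :
    ∀ (c : ℕ) (s : Finset ℕ) (F : IntermediateField ℚ M₀) (m : ℕ), s.card ≤ c → m ≤ k → p ∈ s →
      (∀ q ∈ s, q.Prime) → (∀ q ∈ s, q ∣ n) → F.fixingSubgroup.index = p ^ m →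
      (∀ (Q : Ideal (𝓞 M₀)) [Q.IsMaximal], (∀ q ∈ s, (q : 𝓞 M₀) ∉ Q) →
        Q.inertia (M₀ ≃ₐ[ℚ] M₀) ≤ F.fixingSubgroup) →
      F ≤ T := by
  intro c
  induction c with
  | zero =>
    intro s F m hc _ hps _ _ _ _
    rw [Nat.le_zero, Finset.card_eq_zero] at hc
    subst hc
    exact absurd hps (Finset.notMem_empty p)
  | succ c ih =>
    intro s F m hc hmk hps hprime hdvd hF hFu
    by_cases hsp : ∀ q ∈ s, q = p
    · -- `F` is unramified outside `p`: the prime-power case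
      have hFu' : ∀ (Q : Ideal (𝓞 M₀)) [Q.IsMaximal], (p : 𝓞 M₀) ∉ Q →
          Q.inertia (M₀ ≃ₐ[ℚ] M₀) ≤ F.fixingSubgroup :=
        fun Q _ hpQ => hFu Q fun q hq => by rw [hsp q hq]; exact hpQ
      have hfin : Module.finrank ℚ F = p ^ m := (index_fixingSubgroup F).symm.trans hF
      by_cases hp2 : p = 2
      · subst hp2
        obtain ⟨Cy, hCyT, hCyI⟩ := hCyc (2 ^ (m + 2)) ((pow_dvd_pow 2 (by omega)).trans hpk)
        haveI := hCyI
        exact (IntermediateField.le_of_isCyclotomicExtension_of_finrank_eq_two_pow Cy F hfin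
          hFu').trans hCyT
      · obtain ⟨Cy, hCyT, hCyI⟩ := hCyc (p ^ (m + 1)) ((pow_dvd_pow p (by omega)).trans hpk)
        haveI := hCyI
        exact (IntermediateField.le_of_isCyclotomicExtension_of_finrank_eq_odd_prime_pow hp hp2 Cy
          F hfin hFu').trans hCyT
    · -- absorb a ramified prime `q ≠ p`
      push Not at hsp
      obtain ⟨q, hqs, hqp⟩ := hsp
      have hq : q.Prime := hprime q hqs
      obtain ⟨Cyq, hCyqT, hCyqI⟩ := hCyc q (hdvd q hqs)
      haveI := hCyqI
      obtain ⟨K', ⟨j, hjm, hj⟩, hFK, hq1, hq2⟩ := exists_tame_absorption_le hp F hF hq hqp Cyq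
      have hK' : K' ≤ T := by
        refine ih (s.erase q) K' j ?_ (hjm.trans hmk) (Finset.mem_erase.mpr ⟨hqp.symm, hps⟩)
          (fun q' hq' => hprime q' (Finset.mem_of_mem_erase hq'))
          (fun q' hq' => hdvd q' (Finset.mem_of_mem_erase hq')) hj ?_
        · have := Finset.card_erase_of_mem hqs; omega
        · intro Q _ hQ
          by_cases hqQ : (q : 𝓞 M₀) ∈ Q
          · exact hq1 Q hqQ
          · refine hq2 Q hqQ (hFu Q fun q' hq' => ?_)
            by_cases hqq : q' = q
            · rw [hqq]; exact hqQ
            · exact hQ q' (Finset.mem_erase.mpr ⟨hqq, hq'⟩)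
      exact hFK.trans (sup_le hK' hCyqT)

end Ambient

/-! ### The theorem -/

/-- **The Kronecker–Weber theorem**: every finite abelian extension of `ℚ` inside `ℚ̄` is
contained in a cyclotomic field `ℚ(μ_m)`.  (Washington, Thm. 14.1; Cassels, *Local Fields*,
Thm. 12.2; here by Hilbert's ramification-theoretic proof following Marcus, Ch. 4, Ex. 29–36:
reduction to prime-power degree `p^k` (`kroneckerWeber_of_prime_pow`), passage to the abelian
number field `M₀ = L(ζ_n)` with `n = p^{k+2} ∏ q` over the primes `q ∣ disc L`, removal of the
ramified primes `q ≠ p` and the prime-power case (`le_of_index_eq_prime_pow`).)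
[cite: Washington1997, Ch. 14, Thm. 14.1] [cite: Marcus2018, Ch. 4, Ex. 29–36 (pp. 100–103)] -/
theorem KroneckerWeber_holds : KroneckerWeber := by
  classical
  refine kroneckerWeber_of_prime_pow fun p hp L₀ hfd hab hk => ?_
  obtain ⟨k, hk⟩ := hk
  /- The statement is phrased with the structural `ℚ`-algebra structure on `ℚ̄` while Mathlib's
  number-field library finds `DivisionRing.toRatAlgebra` first; the two agree definitionally, and
  we re-type the data once along this identification. -/
  set L : IntermediateField ℚ (AlgebraicClosure ℚ) := L₀ with hL
  haveI : FiniteDimensional ℚ L := hfd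
  haveI : IsAbelianGalois ℚ L := hab
  haveI : Algebra.IsAlgebraic ℚ (AlgebraicClosure ℚ) := AlgebraicClosure.isAlgebraic ℚ
  haveI : Normal ℚ (AlgebraicClosure ℚ) :=
    @IsAlgClosure.normal ℚ (AlgebraicClosure ℚ) _ _ (AlgebraicClosure.instAlgebra ℚ) inferInstance
  haveI : NumberField L := NumberField.mk
  have hkL : Module.finrank ℚ L = p ^ k := hk
  -- the finite set of bad primes and the level `n`
  set s : Finset ℕ := insert p (discr L).natAbs.primeFactors with hs
  have hsprime : ∀ q ∈ s, q.Prime := by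
    intro q hq
    rw [hs, Finset.mem_insert] at hq
    rcases hq with rfl | hq
    · exact hp
    · exact Nat.prime_of_mem_primeFactors hq
  set n : ℕ := p ^ (k + 2) * ∏ q ∈ s.erase p, q with hn
  have hn0 : 0 < n :=
    Nat.mul_pos (pow_pos hp.pos _)
      (Finset.prod_pos fun q hq => (hsprime q (Finset.mem_of_mem_erase hq)).pos)
  have hpn : p ^ (k + 2) ∣ n := Dvd.intro _ rfl
  have hsn : ∀ q ∈ s, q ∣ n := by
    intro q hq
    by_cases hqp : q = p
    · rw [hqp]; exact (dvd_pow_self p (by omega)).trans hpn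
    · exact (Finset.dvd_prod_of_mem (fun q => q) (Finset.mem_erase.mpr ⟨hqp, hq⟩)).trans
        (dvd_mul_left _ _)
  -- a primitive `n`-th root of unity `ζ ∈ ℚ̄` and the abelian number field `M₀ = L(ζ)`
  haveI : NeZero n := ⟨hn0.ne'⟩
  haveI : NeZero (n : ℚ) := ⟨by exact_mod_cast hn0.ne'⟩
  obtain ⟨ζ, hζ⟩ := HasEnoughRootsOfUnity.exists_primitiveRoot (AlgebraicClosure ℚ) n
  set C : IntermediateField ℚ (AlgebraicClosure ℚ) := IntermediateField.adjoin ℚ {ζ} with hC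
  haveI : IsCyclotomicExtension {n} ℚ C := hζ.intermediateField_adjoin_isCyclotomicExtension (K := ℚ)
  haveI : FiniteDimensional ℚ C :=
    IntermediateField.adjoin.finiteDimensional (Algebra.IsIntegral.isIntegral ζ)
  haveI : IsAbelianGalois ℚ C := IsCyclotomicExtension.isAbelianGalois {n} ℚ C
  set M₀ : IntermediateField ℚ (AlgebraicClosure ℚ) := L ⊔ C with hM₀
  haveI : FiniteDimensional ℚ M₀ := IntermediateField.finiteDimensional_sup L C
  -- `isAbelianGalois_sup` with the hypotheses on `L`, `C` passed explicitly, so that the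
  -- `ℚ`-algebra structure of `ℚ̄` is unified (structural, from `L`) rather than synthesized
  -- (the definitionally equal `DivisionRing.toRatAlgebra`).
  haveI : IsAbelianGalois ℚ M₀ :=
    @isAbelianGalois_sup ℚ (AlgebraicClosure ℚ) _ _ (_) _ L C hfd hab inferInstance
      (IsCyclotomicExtension.isAbelianGalois {n} ℚ C)
  haveI : NumberField M₀ := NumberField.mk
  have hLM : L ≤ M₀ := le_sup_left
  have hCM : C ≤ M₀ := le_sup_right
  -- `F₀ = L` and `T = ℚ(ζ)` as subfields of `M₀`
  set F₀ : IntermediateField ℚ M₀ := IntermediateField.restrict hLM with hF₀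
  set ζ' : M₀ := ⟨ζ, hCM (IntermediateField.mem_adjoin_simple_self ℚ ζ)⟩ with hζ'
  have hζ'prim : IsPrimitiveRoot ζ' n := IsPrimitiveRoot.coe_submonoidClass_iff.mp hζ
  set T : IntermediateField ℚ M₀ := IntermediateField.adjoin ℚ {ζ'} with hT
  have hCyc : ∀ d : ℕ, d ∣ n →
      ∃ Cy : IntermediateField ℚ M₀, Cy ≤ T ∧ IsCyclotomicExtension {d} ℚ Cy := by
    intro d hd
    obtain ⟨e, he⟩ := hd
    haveI : NeZero d := ⟨left_ne_zero_of_mul (he ▸ hn0.ne')⟩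
    have hprim : IsPrimitiveRoot (ζ' ^ e) d := hζ'prim.pow hn0 (by rw [he, mul_comm])
    refine ⟨IntermediateField.adjoin ℚ {ζ' ^ e}, ?_,
      hprim.intermediateField_adjoin_isCyclotomicExtension (K := ℚ)⟩
    rw [IntermediateField.adjoin_simple_le_iff]
    exact pow_mem (IntermediateField.mem_adjoin_simple_self ℚ ζ') e
  -- the degree of `F₀`
  have hF₀fin : Module.finrank ℚ F₀ = p ^ k := by
    rw [← hkL]
    exact (IntermediateField.restrict_algEquiv hLM).toLinearEquiv.finrank_eq.symm
  have hF₀i : F₀.fixingSubgroup.index = p ^ k := (index_fixingSubgroup F₀).trans hF₀fin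
  -- `F₀ ≅ L` is unramified at the primes of `M₀` not meeting `s` (`q ∤ disc L`)
  have hF₀u : ∀ (Q : Ideal (𝓞 M₀)) [Q.IsMaximal], (∀ q ∈ s, (q : 𝓞 M₀) ∉ Q) →
      Q.inertia (M₀ ≃ₐ[ℚ] M₀) ≤ F₀.fixingSubgroup := by
    intro Q _ hQ
    rw [← isUnramifiedAt_under_iff_inertia_le M₀ F₀ Q]
    haveI : (Q.under (𝓞 F₀)).IsMaximal := Ideal.IsMaximal.under (𝓞 F₀) Q
    -- the rational prime `q₀` below `Q ∩ 𝓞 F₀`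
    obtain ⟨g, hg⟩ := IsPrincipalIdealRing.principal ((Q.under (𝓞 F₀)).under ℤ)
    have hg0 : g ≠ 0 := by
      rintro rfl
      exact Ideal.IsMaximal.ne_bot_of_isIntegral_int (Q.under (𝓞 F₀))
        (Ideal.eq_bot_of_comap_eq_bot (hg.trans (by simp)))
    set q₀ := g.natAbs with hq₀
    have hspan : (Q.under (𝓞 F₀)).under ℤ = Ideal.span {(q₀ : ℤ)} := by
      rw [hg, hq₀, Int.span_natAbs]
    haveI : ((Q.under (𝓞 F₀)).under ℤ).IsMaximal := Ideal.IsMaximal.under ℤ _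
    have hq₀prime : q₀.Prime := by
      have h1 : (Ideal.span {(q₀ : ℤ)}).IsPrime := hspan ▸ inferInstance
      rw [Ideal.span_singleton_prime
        (by exact_mod_cast Int.natAbs_ne_zero.mpr hg0 : (q₀ : ℤ) ≠ 0)] at h1
      exact Nat.prime_iff_prime_int.mpr h1
    haveI : (Q.under (𝓞 F₀)).LiesOver (Ideal.span {(q₀ : ℤ)}) := ⟨hspan.symm⟩
    have hq₀mem : ((q₀ : ℤ) : 𝓞 F₀) ∈ Q.under (𝓞 F₀) := by
      have : algebraMap ℤ (𝓞 F₀) (q₀ : ℤ) ∈ Q.under (𝓞 F₀) :=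
        (Ideal.mem_of_liesOver (Q.under (𝓞 F₀)) (Ideal.span {(q₀ : ℤ)}) (q₀ : ℤ)).mp
          (Ideal.mem_span_singleton_self _)
      simpa using this
    -- `q₀ ∉ s` (as `q₀ ∈ Q`), so `q₀ ∤ disc F₀ = disc L`
    have hq₀Q : (q₀ : 𝓞 M₀) ∈ Q := by
      have : algebraMap (𝓞 F₀) (𝓞 M₀) ((q₀ : ℤ) : 𝓞 F₀) ∈ Q := Ideal.mem_comap.mp hq₀mem
      simpa using this
    have hq₀s : q₀ ∉ s := fun h => hQ q₀ h hq₀Q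
    have hdiscL : ¬ (q₀ : ℤ) ∣ discr L := by
      intro h
      apply hq₀s
      rw [hs, Finset.mem_insert]
      right
      rw [Nat.mem_primeFactors]
      exact ⟨hq₀prime, Int.natCast_dvd.mp h, Int.natAbs_ne_zero.mpr (discr_ne_zero L)⟩
    have hdisc : ¬ (q₀ : ℤ) ∣ discr F₀ := by
      have e := NumberField.discr_eq_discr_of_algEquiv L (IntermediateField.restrict_algEquiv hLM)
      intro h
      apply hdiscL
      rw [e]
      exact h
    exact (NumberField.not_dvd_discr_iff_forall_mem F₀ (𝓞 F₀)
      (Nat.prime_iff_prime_int.mp hq₀prime)).mp hdisc (Q.under (𝓞 F₀)) inferInstance hq₀mem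
  -- inside `M₀`: `F₀ ≤ T = ℚ(ζ)`
  have hle : F₀ ≤ T :=
    le_of_index_eq_prime_pow hp hpn T hCyc s.card s F₀ k le_rfl le_rfl
      (Finset.mem_insert_self p _) hsprime hsn hF₀i hF₀u
  -- back in `ℚ̄`: `L = lift F₀ ≤ lift T = ℚ(ζ) ≤ ℚ(μ_n)`
  refine ⟨n, hn0, ?_⟩
  have h1 : L = IntermediateField.lift F₀ := (IntermediateField.lift_restrict hLM).symm
  have h2 : IntermediateField.lift T = IntermediateField.adjoin ℚ {ζ} :=
    IntermediateField.lift_adjoin_simple (K := M₀) (α := ζ')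
  have h3 : IntermediateField.lift F₀ ≤ IntermediateField.lift T := by
    intro x hx
    have hxM : x ∈ M₀ := IntermediateField.lift_le F₀ hx
    exact (IntermediateField.mem_lift (⟨x, hxM⟩ : M₀)).2
      (hle ((IntermediateField.mem_lift (⟨x, hxM⟩ : M₀)).1 hx))
  have h4 : IntermediateField.adjoin ℚ {ζ} ≤
      IntermediateField.adjoin ℚ {x : AlgebraicClosure ℚ | x ^ n = 1} := by
    rw [IntermediateField.adjoin_simple_le_iff]
    exact IntermediateField.subset_adjoin ℚ _ (show ζ ^ n = 1 from hζ.pow_eq_one)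
  have h5 : L ≤ IntermediateField.adjoin ℚ {x : AlgebraicClosure ℚ | x ^ n = 1} := by
    rw [h1]; exact h3.trans (h2.le.trans h4)
  exact h5

end Literature.NumberTheory.GaloisRepresentations
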